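import Literature.Computability.Complexity.UniversalWitnessCircuitsTwoLeaves
import Literature.Computability.Complexity.EasyWitnessGenerator
import Literature.Computability.Complexity.CircuitAdderMultiplier
import Literature.Computability.Complexity.CircuitClassesProofs
import Literature.Computability.MetaComplexity.TruthTablesProofs
import HarnessLib

/-!
# Universal witness circuits: the derandomization leaf of Williams 2010, App. A, reduced to
# IKW's Theorem 12 (2)

Literature / circuit complexity (serves `williams_acc` through `Williams2014Transfer.lean`).
Outcome of the D-0026 bad-split review (2026-08-15) of the named fact
`Williams2010_MA_io_of_not_witnessCircuits` (`UniversalWitnessCircuits.lean`; Williams 2010,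
Appendix A, proof of Lemma 3.1 = Williams 2014, Thm. 5.2, first half: "Suppose there is an
`L ∈ NEXP` which does not have universal witness circuits … we have established
`MA ⊆ i.o.-NTIME[2^{n^{ε'}}]/n^{ε'}` for all `ε' > 0`", held text p. 26 re-read), whose
prove-seat triaged it XL. The review KEEPS the fact — it is the printed intermediate statement,
stated over the tree's classes exactly as its parent glue (`Williams2014_thm_5_2_of_two_leaves`)
consumes it, not an open problem — and PROVES here that it is Impagliazzo–Kabanets–Wigderson's
Thm. 12 (2) "run on guessed witnesses", i.e. reduces it to the tree's existing named fact
`IKW2002_thm12_2` (`IKWGenerators.lean`, itself kept by its own review with the inline discharge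
plan recorded there). What made the leaf look XL — pseudorandom generators from worst-case-hard truth tables
(IKW Thm. 11 = [BFNW93, KvM99]) and the Goldreich–Zuckerman nondeterministic simulation of `MA`
— is entirely inside `IKW2002_thm12_2`; nothing of it is redone or re-vendored here, and no new
named fact is introduced.

The reduction is the MACHINE half of IKW's Lemma 17 already proved in the tree for `NTIME(2ⁿ)`
relations (`EasyWitnessGenerator.lean`: from a total `2ⁿ`-time verifier with, for every exponent,
accepted inputs at infinitely many lengths none of whose accepted witnesses is the payload of an
easy table, `EasyWitness.MA_subset_io_of_frequently_not_easy` builds the hard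
`TruthTableGenerator` and applies Thm. 12 (2)), fed with a `2^{nᵏ}`-time verifier `V` without
witness circuits as follows:

* `NVerifier.exists_pad_machine` — the padded, total form of `V`
  (payload `polyUnpad k z`, witness cut at the admissible length; the machine of
  `padPre_mem_NTIME_two_pow`, `NTIMEPadding.lean`: truncating wrapper + exponential clock, the
  discarded witness read two symbols per step) runs in time `C · 2^{|z|} + C + |y|` on EVERY pair,
  the verifier format of `EasyWitnessGenerator.lean`;
* `exists_circuit_truthTable_drop_prefix` — dropping `J` places of a truth table (a rotation of
  the cube) costs one ripple-carry adder (`ArithCkt.cktSize_addBits`, Vollmer 1999, §1.1) with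
  the constant hardwired: `≤ circuitSizeOver B2 f + 73 m + 3` gates;
  `EasyWitness.exists_circuit_unpad_prefix` — so the payload `unpad (truthTable f)` (front
  padding `0ʲ 1 y` of the easy-witness generator) is a PREFIX of the truth table of a circuit of
  that size, which is the encoding of Williams' witness circuits (`NVerifier.HasWitnessCircuits`:
  the witness is a prefix of a truth table);
* `NVerifier.not_easy_pad` — hence an input all of whose accepted witnesses are `d`-hard in
  Williams' sense is, once padded, not `D`-easy in the sense of `EasyWitness.Easy`
  (`Mᴰ + 73 M + 3 ≤ |x|ᵈ + d`, `exists_shift_budget`);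
* **`Williams2010_MA_io_of_not_witnessCircuits_of_thm12_2`** — the leaf from `IKW2002_thm12_2`
  (hard lengths transported along `x ↦ polyPad k x` by `Filter.Tendsto.frequently`, using the
  proved equivalence `NVerifier.not_hasWitnessCircuits_iff_frequently`);
* `Williams2014_thm_5_2_of_thm12_2`, `Williams2014_thm_5_1_of_thm12_2`,
  `williams_acc_of_thm12_2` — with `EXP_eq_MA_of_subset_PPoly_holds` (`EasyWitnessProofs.lean`)
  now a theorem, the trust base of Williams' Thm. 5.2 / Thm. 5.1 is the SINGLE named fact
  `IKW2002_thm12_2` (shared with `NEXP_eq_EXP_of_subset_PPoly_of_thm12_2`), and that of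
  `williams_acc` along this line is {`Williams2014_fact_3_1`, `IKW2002_thm12_2`,
  `Williams2014_thm_3_2`, `Williams2014_accSat_polysize`}.

The eventual discharge is the one-liner `Williams2010_MA_io_of_not_witnessCircuits_of_thm12_2
IKW2002_thm12_2_holds` once `IKW2002_thm12_2` is proved (plan S1–S3 of `IKWGenerators.lean`).

Nothing here duplicates Mathlib (no complexity classes, no truth tables there) or the tree
(searched `of_thm12_2`, `unpad_prefix`, `drop_prefix`, `Williams2010_MA_io_of_not_witnessCircuits_`;
the adder, the padding machine, the easy-witness generator and the hard-lengths equivalence are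
imported, not rebuilt). No definition is introduced (the padded relation and the rotation are
written out where used).

## References

* R. Williams, *Improving exhaustive search implies superpolynomial lower bounds*, STOC 2010,
  231–240, Def. 3.1–3.2, Lemma 3.1, Appendix A [Williams2010STOC] (held:
  `paper:doi-10-1145-1806689-1806723`, pp. 10 and 26 of the held text, re-read 2026-08-15).
* R. Williams, *Nonuniform ACC circuit lower bounds*, J. ACM 61 (2014) 2:1–2:32, §5, Thm. 5.1,
  Thm. 5.2, Thm. 1.1 [Williams2014].
* R. Impagliazzo, V. Kabanets, A. Wigderson, *In search of an easy witness: exponential time vs.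
  probabilistic polynomial time*, JCSS 65 (2002) 672–694, §2.2, Thm. 12 (2), Lemma 17, Thm. 31
  [ImpagliazzoKabanetsWigderson2002].
* S. Arora, B. Barak, *Computational Complexity: A Modern Approach*, CUP 2009, §2.6.2 (padding),
  proof of Lemma 20.20 (p. 417) [AroraBarakCC2009].
* H. Vollmer, *Introduction to Circuit Complexity*, Springer 1999, §1.1 (ripple-carry adder)
  [Vollmer1999].
-/

noncomputable section

namespace Literature.Computability.Complexity

open _root_.Computability Turing Filter

/-! ### Dropping places of a truth table (rotation by a ripple-carry adder) -/

section Shift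

variable {m : ℕ}

/-- The index of a cube point in the tree's enumeration is the number spelled by its bits
(Batteries' `Nat.ofBits`, least significant bit first). [folklore] -/
theorem val_boolFunEquivFin_eq_ofBits (v : Fin m → Bool) :
    ((MetaComplexity.boolFunEquivFin m v : Fin (2 ^ m)) : ℕ) = Nat.ofBits v := by
  apply Nat.eq_of_testBit_eq
  intro i
  by_cases hi : i < m
  · rw [Nat.testBit_ofBits_lt _ _ hi]
    have h := boolFunEquivFin_symm_apply m
      ((MetaComplexity.boolFunEquivFin m v : Fin (2 ^ m)) : ℕ) (Fin.isLt _) ⟨i, hi⟩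
    rw [Fin.eta, Equiv.symm_apply_apply] at h
    exact h.symm
  · rw [Nat.testBit_ofBits_ge _ _ (not_lt.1 hi)]
    exact Nat.testBit_eq_false_of_lt
      ((Fin.isLt _).trans_le (Nat.pow_le_pow_right Nat.two_pos (not_lt.1 hi)))

/-- **Dropping `J` places of a truth table costs one adder.** For every `m`-variable `f` and every
`J` there is a `B₂`-circuit `W` on `m` inputs with at most `circuitSizeOver B2 f + 73 m + 3` gates
whose truth table begins with `(truthTable f) ↓ J`: `W` computes the rotation
`v ↦ f (⟨v⟩ + J mod 2ᵐ)` of `f` — a minimal circuit for `f`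
(`exists_computes_B2_size_eq_holds`) fed by the ripple-carry adder `ArithCkt.cktSize_addBits`
(`73 m + 1` gates; Vollmer 1999, §1.1) with the constant `J` hardwired (`CktSize.hardwire`,
`+ 2`). [cite: Vollmer1999, §1.1] -/
theorem exists_circuit_truthTable_drop_prefix (f : (Fin m → Bool) → Bool) (J : ℕ) :
    ∃ W : Circuit (Fin m), W.IsOver B2 ∧ W.size ≤ circuitSizeOver B2 f + (73 * m + 3) ∧
      (MetaComplexity.truthTable f).drop J <+: MetaComplexity.truthTable W.eval := by
  -- the rotation `g` of `f` by `J` places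
  set g : (Fin m → Bool) → Bool := fun v => f ((MetaComplexity.boolFunEquivFin m).symm
      ⟨((MetaComplexity.boolFunEquivFin m v : ℕ) + J) % 2 ^ m,
        Nat.mod_lt _ (Nat.two_pow_pos m)⟩) with hg
  -- its truth table, read at `i`, is that of `f` read at `J + i`
  have hget : ∀ (i : ℕ) (hi : J + i < 2 ^ m),
      (MetaComplexity.truthTable g)[i]'(by simp; omega) =
        (MetaComplexity.truthTable f)[J + i]'(by simpa using hi) := by
    intro i hi
    simp only [MetaComplexity.truthTable, List.getElem_ofFn, hg]
    congr 1
    congr 1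
    apply Fin.ext
    simp only [Equiv.apply_symm_apply]
    rw [Nat.mod_eq_of_lt (by omega)]
    omega
  -- hence `(truthTable f) ↓ J` is a prefix of it
  have hdrop : (MetaComplexity.truthTable f).drop J <+: MetaComplexity.truthTable g := by
    rw [List.prefix_iff_eq_take]
    symm
    apply List.ext_getElem
    · simp only [List.length_take, List.length_drop, MetaComplexity.length_truthTable]
      generalize 2 ^ m = N
      omega
    · intro i h₁ h₂
      simp only [List.length_take, List.length_drop, MetaComplexity.length_truthTable] at h₁ h₂
      rw [List.getElem_take, List.getElem_drop, hget i (by omega)]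
  -- the circuit: a minimal circuit for `f` after the adder with `J` hardwired
  obtain ⟨C, hCB, hCf, hCs⟩ := MetaComplexity.exists_computes_B2_size_eq_holds (n := m) f
  have h1 : CktSize B2 (fun (v : Fin m → Bool) (_ : Unit) => f v) C.size :=
    (C.cktSize_eval hCB).congr fun v _ => hCf v
  have h3 : CktSize B2 (fun (u : Fin (m + 1) → Bool) (_ : Unit) => f fun i => u (Fin.castSucc i))
      C.size :=
    h1.rewire Fin.castSucc
  have h4 : CktSize B2 (fun (x : Fin m ⊕ Fin m → Bool) (_ : Unit) =>
      f fun i => ArithCkt.addBits m x (Fin.castSucc i)) (ArithCkt.addSize m + C.size) :=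
    (ArithCkt.cktSize_addBits m).comp h3
  have h5 := h4.hardwire fun i : Fin m => J.testBit i
  obtain ⟨W, hWB, hWs, hWe⟩ := h5.toCircuit
  refine ⟨W, hWB, ?_, ?_⟩
  · rw [← hCs]
    simp only [ArithCkt.addSize] at hWs
    omega
  · -- `W` computes `g`
    have hWg : W.eval = g := by
      funext v
      rw [hWe, hg]
      congr 1
      funext i
      rw [boolFunEquivFin_symm_apply]
      simp only [ArithCkt.addBits, ArithCkt.bitsOf, ArithCkt.addVal, Fin.val_castSucc,
        Sum.elim_inl, Sum.elim_inr]
      rw [Nat.ofBits_testBit, val_boolFunEquivFin_eq_ofBits]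
      have key : ∀ x : ℕ, x.testBit (i : ℕ) = (x % 2 ^ m).testBit (i : ℕ) := fun x => by
        rw [Nat.testBit_mod_two_pow]
        simp [i.isLt]
      conv_lhs => rw [key, Nat.add_mod_mod]
    rw [hWg]
    exact hdrop

end Shift

/-! ### The front padding of the easy-witness generator -/

/-- Structure of `EasyWitness.unpad`: either the string is `0ʲ 1 (unpad t)`, or it has no `1` to
strip and `unpad t = ε`. [folklore] -/
theorem EasyWitness.unpad_split : ∀ t : List Bool,
    (∃ j, t = List.replicate j false ++ true :: EasyWitness.unpad t) ∨ EasyWitness.unpad t = []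
  | [] => Or.inr rfl
  | true :: _ => Or.inl ⟨0, rfl⟩
  | false :: t => by
    rcases EasyWitness.unpad_split t with ⟨j, hj⟩ | h
    · refine Or.inl ⟨j + 1, ?_⟩
      show false :: t = List.replicate (j + 1) false ++ true :: EasyWitness.unpad t
      rw [List.replicate_succ, List.cons_append, ← hj]
    · exact Or.inr h

/-- **The payload of a table rides on a small circuit.** The payload `unpad (truthTable f)` of the
front-padding code `0ʲ 1 y` (by which the easy-witness generator of `EasyWitnessGenerator.lean`
carries witnesses on tables) is a PREFIX — the encoding of Williams' witness circuits — of the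
truth table of a `B₂`-circuit with at most `circuitSizeOver B2 f + 73 m + 3` gates
(`exists_circuit_truthTable_drop_prefix` with `J = j + 1`). [folklore] -/
theorem EasyWitness.exists_circuit_unpad_prefix {m : ℕ} (f : (Fin m → Bool) → Bool) :
    ∃ W : Circuit (Fin m), W.IsOver B2 ∧ W.size ≤ circuitSizeOver B2 f + (73 * m + 3) ∧
      EasyWitness.unpad (MetaComplexity.truthTable f) <+: MetaComplexity.truthTable W.eval := by
  rcases EasyWitness.unpad_split (MetaComplexity.truthTable f) with ⟨j, hj⟩ | h
  · have hdrop : (MetaComplexity.truthTable f).drop (j + 1) =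
        EasyWitness.unpad (MetaComplexity.truthTable f) := by
      conv_lhs => rw [hj]
      rw [← List.singleton_append, ← List.append_assoc]
      exact List.drop_left' (by simp)
    rw [← hdrop]
    exact exists_circuit_truthTable_drop_prefix f (j + 1)
  · obtain ⟨W, hWB, hWs, -⟩ := exists_circuit_truthTable_drop_prefix f 0
    exact ⟨W, hWB, hWs, h ▸ List.nil_prefix⟩

/-! ### The padded, total form of a `2^{nᵏ}`-time verifier -/

/-- **Hard inputs of `V` are hard for the padded relation.** The padded relation of `V` reads, on
`⟨z, y⟩`, the payload `polyUnpad k z` and the witness cut at the admissible length. If every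
accepted admissible witness of `x` fails to be a prefix of the truth table of any `B₂`-circuit
with `≤ |x|ᵈ + d` gates, and `Mᴰ + 73 M + 3 ≤ |x|ᵈ + d`, then the pad `polyPad k x` is not
`D`-easy at table size `M` for the padded relation (`EasyWitness.Easy`): an easy table
`truthTable f` (circuit complexity `≤ Mᴰ`) would carry the accepted witness
`(unpad (truthTable f)) ↾ B` as a prefix of the truth table of a circuit of size
`≤ Mᴰ + 73 M + 3` (`EasyWitness.exists_circuit_unpad_prefix`). [folklore] -/
theorem NVerifier.not_easy_pad {k : ℕ} {L : Language Bool}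
    (V : NVerifier (fun n => 2 ^ (n ^ k)) L) {d D M : ℕ} {x : List Bool}
    (hx : ∀ (m : ℕ) (W : Circuit (Fin m)) (y : List Bool), W.IsOver B2 →
      W.size ≤ x.length ^ d + d → y.length ≤ V.c * 2 ^ (x.length ^ k) + V.c →
        V.rel x y = true → ¬ y <+: MetaComplexity.truthTable W.eval)
    (hM : M ^ D + (73 * M + 3) ≤ x.length ^ d + d) :
    ¬ EasyWitness.Easy
      (fun z y => V.rel (polyUnpad k z) (y.take (V.c * 2 ^ ((polyUnpad k z).length ^ k) + V.c)))
      D M (polyPad k x) := by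
  rintro ⟨f, hfs, hR⟩
  simp only [polyUnpad_polyPad] at hR
  obtain ⟨W, hWB, hWs, hW⟩ := EasyWitness.exists_circuit_unpad_prefix f
  exact hx M W _ hWB (hWs.trans ((Nat.add_le_add_right hfs _).trans hM)) (List.length_take_le _ _)
    hR ((List.take_prefix _ _).trans hW)

/-- **The padded verifier is total, in time `C · 2^{|z|} + C + |y|` on every pair** (the machine
of `padPre_mem_NTIME_two_pow`, Arora–Barak 2009, §2.6.2: the truncating wrapper `truncMapAux`
fed by the clock `z ↦ expClock c k (polyUnpad k z)`, then `V`'s machine; the discarded witness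
is read two symbols per step). The constant also dominates `2 · V.c`.
[cite: AroraBarakCC2009, §2.6.2 (Thm. 2.22)] -/
theorem NVerifier.exists_pad_machine {k : ℕ} {L : Language Bool}
    (V : NVerifier (fun n => 2 ^ (n ^ k)) L) :
    ∃ (C : ℕ) (M : TM2ComputableAux Bool Bool), 2 * V.c ≤ C ∧
      ∀ z y : List Bool, M.OutputsWithin (boolPair z y)
        (encodeBool (V.rel (polyUnpad k z) (y.take (V.c * 2 ^ ((polyUnpad k z).length ^ k) + V.c))))
        (C * 2 ^ z.length + C + y.length) := by
  obtain ⟨q, C₀, Nc, hNc⟩ := exists_clock_machine V.c k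
  obtain ⟨b, hb⟩ := TimeConstructible.exists_poly_le_two_pow_pow
    (q + 5 * Polynomial.X + 11) (k := 1) le_rfl
  refine ⟨b + 2 * C₀ + 9 * V.c, (truncMapAux Nc).comp V.machine, by omega, fun z y => ?_⟩
  set x₀ := polyUnpad k z with hx₀
  set n₀ := x₀.length with hn₀
  have hclock := hNc z
  rw [← hx₀] at hclock
  have h₁ := outputsWithin_truncMapAux_boolPair Nc (y := y) hclock
  simp only [List.length_replicate, ← hn₀] at h₁
  have hy' : (y.take (V.c * 2 ^ (n₀ ^ k) + V.c)).length ≤ V.c * 2 ^ (n₀ ^ k) + V.c :=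
    List.length_take_le _ _
  have h₂ : V.machine.OutputsWithin (boolPair x₀ (y.take (V.c * 2 ^ (n₀ ^ k) + V.c)))
      (encodeBool (V.rel x₀ (y.take (V.c * 2 ^ (n₀ ^ k) + V.c))))
      (V.c * 2 ^ (n₀ ^ k) + V.c) := by
    have := V.outputsWithin x₀ (y.take (V.c * 2 ^ (n₀ ^ k) + V.c)) hy'
    rwa [← hn₀] at this
  have h := Turing.TM2ComputableAux.comp_outputsWithin _ _ h₁ h₂
  refine h.mono ?_
  have hpow : 2 ^ (n₀ ^ k) ≤ 2 * 2 ^ z.length := by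
    rw [hn₀, hx₀]; exact two_pow_length_polyUnpad_le k z
  have hn₀z : n₀ ≤ z.length := by rw [hn₀, hx₀]; exact length_polyUnpad_le k z
  have hbz := hb z.length
  simp only [Polynomial.eval_add, Polynomial.eval_mul, Polynomial.eval_ofNat, Polynomial.eval_X,
    pow_one] at hbz
  have e1 : V.c * 2 ^ (n₀ ^ k) ≤ V.c * (2 * 2 ^ z.length) := Nat.mul_le_mul_left _ hpow
  have e2 : C₀ * 2 ^ (n₀ ^ k) ≤ C₀ * (2 * 2 ^ z.length) := Nat.mul_le_mul_left _ hpow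
  have hy2 : y.length / 2 ≤ y.length := Nat.div_le_self _ _
  nlinarith [e1, e2, hbz, hy2, hn₀z, Nat.one_le_two_pow (n := z.length)]

/-- Polynomial budgets are eventually below `nᵈ + d` for a suitable exponent `d`: here the size
`Mᴰ + 73 M + 3` of the witness circuit at table size `M = (2n + 2 + nᵏ) + (C + 1)`
(`exists_eval_le_mul_pow_add`). [folklore] -/
theorem exists_shift_budget (k C D : ℕ) : ∃ d N₀ : ℕ, ∀ n : ℕ, N₀ ≤ n →
    (2 * n + 2 + n ^ k + (C + 1)) ^ D + (73 * (2 * n + 2 + n ^ k + (C + 1)) + 3) ≤ n ^ d + d := by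
  obtain ⟨c, e, hce⟩ := exists_eval_le_mul_pow_add
    ((2 * Polynomial.X + 2 + Polynomial.X ^ k + Polynomial.C (C + 1)) ^ D +
      (73 * (2 * Polynomial.X + 2 + Polynomial.X ^ k + Polynomial.C (C + 1)) + 3))
  refine ⟨e + 1 + c, c + 1, fun n hn => ?_⟩
  have h := hce n
  simp only [Polynomial.eval_add, Polynomial.eval_pow, Polynomial.eval_mul, Polynomial.eval_ofNat,
    Polynomial.eval_X, Polynomial.eval_C] at h
  have h1 : c * n ^ e ≤ n ^ (e + 1) := by
    rw [pow_succ']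
    exact Nat.mul_le_mul_right _ (by omega)
  have h2 : n ^ (e + 1) ≤ n ^ (e + 1 + c) := Nat.pow_le_pow_right (by omega) (by omega)
  omega

/-! ### The leaf from IKW's Theorem 12 (2) -/

/-- **Williams 2010, App. A (first half) from IKW 2002, Thm. 12 (2).** A `2^{nᵏ}`-time verifier
`V` without witness circuits yields `MA ⊆ io-[NTIME(2^{n^ε})/n^ε]` for every `ε > 0`, GIVEN the
named fact `IKW2002_thm12_2`: the padded total form of `V` (`exists_pad_machine`) is a total
`2ⁿ`-time verifier in the sense of `EasyWitnessGenerator.lean`; its hard inputs for every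
exponent at infinitely many lengths (`NVerifier.not_hasWitnessCircuits_iff_frequently`,
transported along `x ↦ polyPad k x` and `not_easy_pad`) make the easy-witness generator
superpolynomially hard infinitely often, and `EasyWitness.MA_subset_io_of_frequently_not_easy`
(IKW Lemma 17 + Thm. 12 (2)) concludes. [cite: Williams2010STOC, Appendix A (proof of Lemma 3.1)]
[cite: ImpagliazzoKabanetsWigderson2002, Thm. 12 (2) and Lemma 17] -/
theorem Williams2010_MA_io_of_not_witnessCircuits_of_thm12_2 (h12 : IKW2002_thm12_2) :
    Williams2010_MA_io_of_not_witnessCircuits := by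
  intro L k V hV ε hε
  obtain ⟨C, M, hCc, hM⟩ := V.exists_pad_machine
  -- the padded relation
  set R : List Bool → List Bool → Bool := fun z y =>
    V.rel (polyUnpad k z) (y.take (V.c * 2 ^ ((polyUnpad k z).length ^ k) + V.c)) with hR
  -- completeness of the padded relation on the padded language
  have hmem : ∀ z : List Bool, z ∈ padPre k L →
      ∃ y : List Bool, y.length ≤ C * 2 ^ z.length + C ∧ R z y = true := by
    intro z hz
    rw [mem_padPre] at hz
    obtain ⟨y, hy, hrel⟩ := (V.mem_iff _).1 hz
    have hy' : y.length ≤ V.c * 2 ^ ((polyUnpad k z).length ^ k) + V.c := hy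
    refine ⟨y, ?_, ?_⟩
    · have hpow := two_pow_length_polyUnpad_le k z
      calc y.length ≤ V.c * 2 ^ ((polyUnpad k z).length ^ k) + V.c := hy'
        _ ≤ V.c * (2 * 2 ^ z.length) + V.c := by gcongr
        _ = (2 * V.c) * 2 ^ z.length + V.c := by ring
        _ ≤ C * 2 ^ z.length + C := by
          have h2 : V.c ≤ C := by omega
          gcongr
    · simp only [hR]
      rwa [List.take_of_length_le hy']
  -- hard inputs for every exponent at infinitely many lengths, padded
  have hhard : ∀ D : ℕ, ∃ᶠ n in atTop, ∃ z ∈ padPre k L, z.length = n ∧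
      ¬ EasyWitness.Easy R D (n + (C + 1)) z := by
    intro D
    obtain ⟨d, N₀, hdom⟩ := exists_shift_budget k C D
    have hfreq := ((V.not_hasWitnessCircuits_iff_frequently).1 hV d).and_eventually
      (eventually_ge_atTop N₀)
    have hπ : Tendsto (fun n : ℕ => 2 * n + 2 + n ^ k) atTop atTop :=
      tendsto_atTop_atTop.2 fun b => ⟨b, fun n hn => hn.trans (by omega)⟩
    refine hπ.frequently (hfreq.mono ?_)
    rintro n ⟨⟨x, hxL, hxn, hx⟩, hn⟩
    refine ⟨polyPad k x, by simpa [mem_padPre] using hxL, by simp [hxn], ?_⟩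
    have h := V.not_easy_pad (D := D) (M := 2 * n + 2 + n ^ k + (C + 1)) hx
      (by rw [hxn]; exact hdom n hn)
    simpa only [hR, Nat.add_assoc] using h
  exact EasyWitness.MA_subset_io_of_frequently_not_easy (R := R) h12 hM hmem hhard hε

/-! ### Consequences: Williams' Thm. 5.2, Thm. 5.1 and Thm. 1.1 on the leaf `IKW2002_thm12_2` -/

/-- **Williams 2014, Thm. 5.2 from IKW's Thm. 12 (2) alone**: "If `NEXP ⊆ P/poly` then every
language in `NEXP` has universal witness circuits of polynomial size", from the named fact
`IKW2002_thm12_2` — `EXP ⊆ P/poly ⟹ EXP = MA` is the tree's theorem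
`EXP_eq_MA_of_subset_PPoly_holds`, the derandomization leaf is
`Williams2010_MA_io_of_not_witnessCircuits_of_thm12_2`, IKW's Lemma 5 and Thm. 2 are theorems
(`Williams2014_thm_5_2_of_two_leaves`). [cite: Williams2014, Thm. 5.2]
[cite: Williams2010STOC, Lemma 3.1 and Appendix A] -/
theorem Williams2014_thm_5_2_of_thm12_2 (h12 : IKW2002_thm12_2) : Williams2014_thm_5_2 :=
  Williams2014_thm_5_2_of_two_leaves EXP_eq_MA_of_subset_PPoly_holds
    (Williams2010_MA_io_of_not_witnessCircuits_of_thm12_2 h12)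

/-- **Williams 2014, Thm. 5.1 (succinct satisfying assignments) from IKW's Thm. 12 (2) alone.**
[cite: Williams2014, Thm. 5.1 and Thm. 5.2] -/
theorem Williams2014_thm_5_1_of_thm12_2 (h12 : IKW2002_thm12_2) : Williams2014_thm_5_1 :=
  Williams2014_thm_5_1_of_two_leaves EXP_eq_MA_of_subset_PPoly_holds
    (Williams2010_MA_io_of_not_witnessCircuits_of_thm12_2 h12)

/-- **Williams' Theorem 1.1 (`NTIME(2ⁿ) ⊄ ACC⁰`, `williams_acc`)** from Fact 3.1, IKW's
Thm. 12 (2), Thm. 3.2 (with Lemma 3.1) and the `ACC`-SAT algorithm of Thm. 4.1; the hierarchy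
theorem, IKW's Lemma 5, Thm. 2 and Thm. 22 from the tree
(`williams_acc_of_two_easyWitness_leaves`).
[cite: Williams2014, Thm. 1.1 and its proof] -/
theorem williams_acc_of_thm12_2 (h31 : Williams2014_fact_3_1) (h12 : IKW2002_thm12_2)
    (h32 : Williams2014_thm_3_2) (h41 : Williams2014_accSat_polysize) : williams_acc :=
  williams_acc_of_two_easyWitness_leaves h31 EXP_eq_MA_of_subset_PPoly_holds
    (Williams2010_MA_io_of_not_witnessCircuits_of_thm12_2 h12) h32 h41

end Literature.Computability.Complexity

end
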